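import Summits.CriticalPhenomena.CardyFormulaZ2.Theorems.CardyIKTransportIKLinearTransportStubPinnedSamplerCFTPLaw

/-!
# Stub `stub_PinnedSampler` — coupling from the past along rows, part 3a: preparations for THE PINNED
# SAMPLER from a coalescing row dynamics (constants, sure covariance, transfer along the strip diagram
# exchange, almost sure finiteness of certified depths)

Theorem-only support file (`--supports stmt-CriticalPhenomena-5076`, registered sub-goal
`ps2_stat_prod_map`; the assembly is part 3b, `…StubPinnedSamplerCFTP.lean`, registered sub-goal
`ps2_pinnedSampler_of_rowCFTP`). THE CODING STEP of the remaining content of `stub_PinnedSampler`: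
given, for the admissible pair `(S, i)`, a ROW-RESAMPLING DYNAMICS `Φ` of the middle data in the
environment `p = (eraseMid i x, stripDiagram i x)` — measurable, rewriting only the middle row it visits,
vertically covariant, and EXACT (every sweep of the rows `a … a+n-1` from `X' ∼ νmix (S ∆ {i,i+1})` with fresh
bits has, jointly with the pinned statistic and on the events not reading the rows `≥ a+n`, the law of
`X'`: the row maps sample the conditional law of a middle row given the statistic and the rows below) — together with measurable, sound, vertically covariant CERTIFIED COALESCENCE events `Coal y m`
whose failure probability under `νmix S ⊗ β` is `≤ C e^{-c m}`, and local approximants of the depth-`r`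
sweeps off an event of probability `≤ C e^{-c r}` (the dynamical form of strong spatial mixing in mean),
the COUPLING-FROM-THE-PAST map `G x u` (off the middle: `x`; middle row `y`: the bits of the first
certified sweep ending at `y`, started blank) is a pinned sampler with constants
`(max C 0 · (2 + 4/c), c/2)`: measurable; `eraseMid` preserved surely; strip diagram preserved almost
surely and the exchanged law transported (Propp–Wilson, `ps2_cftp_jointLaw`, transferred from
`S ∆ {i,i+1}` to `S` along `StripDiagramExchange`); vertically covariant surely; quasi-local with
exponential tails (union bound over the `2r+1` rows of the ball plus the local-approximation event); the
null-set upgrade `ps_pinnedSampler_of_ae` (p94837) makes every clause sure. What remains of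
`stub_PinnedSampler` after this file is the existence, uniformly in `(S, i)`, of such a pair `(Φ, Coal)`:
exponential coalescence IN MEAN of the grand coupling of the diagram-conditioned middle-column chain.
-/

noncomputable section

namespace Summit.CriticalPhenomena.CardyFormulaZ2.Theorems.IKLinearTransport.PinnedDiagramExchange

open scoped Classical MeasureTheory ENNReal ProbabilityTheory symmDiff Topology
open Set MeasureTheory Filter
open Literature.Probability.Percolation Literature.Probability.LatticeModels

/-! ## Constants -/

/-- `(2r+2) C e^{-cr} ≤ C (2 + 4/c) e^{-(c/2) r}` for `C ≥ 0 < c`. [folklore] -/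
theorem ps2_const_bound {C c : ℝ} (hc : 0 < c) (hC : 0 ≤ C) (r : ℕ) :
    (2 * r + 2) * (C * Real.exp (-c * r)) ≤ C * (2 + 4 / c) * Real.exp (-(c / 2) * r) := by
  have hr : (0 : ℝ) ≤ r := Nat.cast_nonneg r
  set t : ℝ := c / 2 * r with ht
  have ht0 : 0 ≤ t := by positivity
  have hexp : Real.exp (-c * r) = Real.exp (-(c / 2) * r) * Real.exp (-t) := by
    rw [← Real.exp_add]; congr 1; rw [ht]; ring
  have hkey : t * Real.exp (-t) ≤ 1 := by
    have h1 : t ≤ Real.exp t := by linarith [Real.add_one_le_exp t]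
    have h2 : Real.exp t * Real.exp (-t) = 1 := by rw [← Real.exp_add, add_neg_cancel, Real.exp_zero]
    calc t * Real.exp (-t) ≤ Real.exp t * Real.exp (-t) :=
          mul_le_mul_of_nonneg_right h1 (Real.exp_pos _).le
      _ = 1 := h2
  have hr' : (r : ℝ) = 2 / c * t := by rw [ht]; field_simp
  have hbound : (2 * r + 2) * Real.exp (-t) ≤ 2 + 4 / c := by
    have h3 : Real.exp (-t) ≤ 1 := by rw [Real.exp_le_one_iff]; linarith
    have h4 : 2 * r * Real.exp (-t) ≤ 4 / c := by
      rw [hr']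
      calc 2 * (2 / c * t) * Real.exp (-t) = 4 / c * (t * Real.exp (-t)) := by ring
        _ ≤ 4 / c * 1 := by gcongr
        _ = 4 / c := mul_one _
    nlinarith
  calc (2 * r + 2) * (C * Real.exp (-c * r))
      = C * Real.exp (-(c / 2) * r) * ((2 * r + 2) * Real.exp (-t)) := by rw [hexp]; ring
    _ ≤ C * Real.exp (-(c / 2) * r) * (2 + 4 / c) := by gcongr
    _ = C * (2 + 4 / c) * Real.exp (-(c / 2) * r) := by ring

section Assembly

variable {S : Set ℤ} {i : ℤ} {Φ : ℤ → Obs × Set (Site 2 × Site 2) → Rnd → Obs → Obs}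
  {T : ℕ → ℤ → Obs × Set (Site 2 × Site 2) → Rnd → Obs → Obs}
  {Coal : ℤ → ℕ → Set ((Obs × Set (Site 2 × Site 2)) × Rnd)}
  {g : (Obs × Set (Site 2 × Site 2)) × Rnd → Obs}

/-- Covariance of the sweeps started blank. [folklore] -/
theorem ps2_sweep_cov_blank
    (hT : ∀ n a p u z, T n a p u z = ((fun q : ℤ × Obs => (q.1 + 1, Φ q.1 p u q.2))^[n] (a, z)).2)
    (hΦcov : ∀ (y k : ℤ) (x : Obs) (u : Rnd) (z : Obs),
      Φ y (eraseMid i (vshift k x), stripDiagram i (vshift k x)) (ushift k u) (vshift k z) =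
        vshift k (Φ (y - k) (eraseMid i x, stripDiagram i x) u z))
    (n : ℕ) (a k : ℤ) (x : Obs) (u : Rnd) :
    T n a (eraseMid i (vshift k x), stripDiagram i (vshift k x)) (ushift k u) (eraseMid i (vshift k x)) =
      vshift k (T n (a - k) (eraseMid i x, stripDiagram i x) u (eraseMid i x)) := by
  conv_lhs => rw [show eraseMid i (vshift k x) = vshift k (eraseMid i x) from ps2_eraseMid_vshift i k x]
  rw [← ps2_sweep_cov hT hΦcov n a k x u (eraseMid i x), ← ps2_eraseMid_vshift]

/-- The CFTP map rewrites only the middle data: `eraseMid` is preserved SURELY. [folklore] -/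
theorem ps2_cftp_eraseMid
    (hg1 : ∀ p u (w : Site 2), w ∈ (g (p, u)).1 ↔ if w 0 = i + 1 then
      ∃ m : ℕ, ((p, u) ∈ Coal (w 1) m ∧ ∀ m' < m, (p, u) ∉ Coal (w 1) m') ∧
        w ∈ (T (m + 1) (w 1 - m) p u p.1).1 else w ∈ p.1.1)
    (hg2 : ∀ p u (f : Site 2), f ∈ (g (p, u)).2 ↔ if (f 0 = i ∨ f 0 = i + 1) then
      ∃ m : ℕ, ((p, u) ∈ Coal (f 1) m ∧ ∀ m' < m, (p, u) ∉ Coal (f 1) m') ∧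
        f ∈ (T (m + 1) (f 1 - m) p u p.1).2 else f ∈ p.1.2)
    (x : Obs) (u : Rnd) : eraseMid i (g ((eraseMid i x, stripDiagram i x), u)) = eraseMid i x := by
  refine eraseMid_eq_of_agree i _ _ (fun v hv => ?_) (fun f hf1 hf2 => ?_)
  · rw [hg1, if_neg hv]
    simp only [eraseMid, mem_setOf_eq, and_iff_left_iff_imp]
    exact fun _ => hv
  · rw [hg2, if_neg (not_or.2 ⟨hf1, hf2⟩)]
    simp only [eraseMid, mem_setOf_eq, and_iff_left_iff_imp]
    exact fun _ => ⟨hf1, hf2⟩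

/-- The CFTP map is vertically covariant SURELY (row maps and coalescence events are). [folklore] -/
theorem ps2_cftp_cov
    (hT : ∀ n a p u z, T n a p u z = ((fun q : ℤ × Obs => (q.1 + 1, Φ q.1 p u q.2))^[n] (a, z)).2)
    (hΦcov : ∀ (y k : ℤ) (x : Obs) (u : Rnd) (z : Obs),
      Φ y (eraseMid i (vshift k x), stripDiagram i (vshift k x)) (ushift k u) (vshift k z) =
        vshift k (Φ (y - k) (eraseMid i x, stripDiagram i x) u z))
    (hCcov : ∀ (y : ℤ) (m : ℕ) (k : ℤ) (x : Obs) (u : Rnd),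
      ((eraseMid i (vshift k x), stripDiagram i (vshift k x)), ushift k u) ∈ Coal y m ↔
        ((eraseMid i x, stripDiagram i x), u) ∈ Coal (y - k) m)
    (hg1 : ∀ p u (w : Site 2), w ∈ (g (p, u)).1 ↔ if w 0 = i + 1 then
      ∃ m : ℕ, ((p, u) ∈ Coal (w 1) m ∧ ∀ m' < m, (p, u) ∉ Coal (w 1) m') ∧
        w ∈ (T (m + 1) (w 1 - m) p u p.1).1 else w ∈ p.1.1)
    (hg2 : ∀ p u (f : Site 2), f ∈ (g (p, u)).2 ↔ if (f 0 = i ∨ f 0 = i + 1) then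
      ∃ m : ℕ, ((p, u) ∈ Coal (f 1) m ∧ ∀ m' < m, (p, u) ∉ Coal (f 1) m') ∧
        f ∈ (T (m + 1) (f 1 - m) p u p.1).2 else f ∈ p.1.2)
    (k : ℤ) (x : Obs) (u : Rnd) :
    g ((eraseMid i (vshift k x), stripDiagram i (vshift k x)), ushift k u) =
      vshift k (g ((eraseMid i x, stripDiagram i x), u)) := by
  have h0 : ∀ w : Site 2, (w - ![0, k]) 0 = w 0 := fun w => (ps2_sub_vec_apply w k).1
  have h1 : ∀ w : Site 2, (w - ![0, k]) 1 = w 1 - k := fun w => (ps2_sub_vec_apply w k).2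
  have hsw : ∀ (m : ℕ) (y : ℤ), T (m + 1) (y - m) (eraseMid i (vshift k x), stripDiagram i (vshift k x))
      (ushift k u) (eraseMid i (vshift k x)) =
      vshift k (T (m + 1) (y - k - m) (eraseMid i x, stripDiagram i x) u (eraseMid i x)) := by
    intro m y
    rw [ps2_sweep_cov_blank hT hΦcov, show y - m - k = y - k - m by ring]
  refine Prod.ext (Set.ext fun w => ?_) (Set.ext fun f => ?_)
  · rw [(ps2_mem_vshift k _ w).1, hg1, hg1, h0, h1]
    simp only [hCcov, hsw, (ps2_mem_vshift k _ _).1]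
    simp only [ps2_eraseMid_vshift, (ps2_mem_vshift k _ _).1]
  · rw [(ps2_mem_vshift k _ f).2, hg2, hg2, h0, h1]
    simp only [hCcov, hsw, (ps2_mem_vshift k _ _).2]
    simp only [ps2_eraseMid_vshift, (ps2_mem_vshift k _ _).2]

/-- The pinned statistic, paired with the fresh bits, has the same law under the pattern `S` and under
the exchanged pattern, given `StripDiagramExchange S i` (registered sub-goal). [folklore] -/
theorem ps2_stat_prod_map : ∀ (S : Set ℤ) (i : ℤ), StripDiagramExchange S i →
    ((νmix S).prod β).map (fun xu : Obs × Rnd => ((eraseMid i xu.1, stripDiagram i xu.1), xu.2)) =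
      ((νmix (symmDiff S {i, i + 1})).prod β).map
        (fun xu : Obs × Rnd => ((eraseMid i xu.1, stripDiagram i xu.1), xu.2)) := by
  intro S i hX
  haveI : IsProbabilityMeasure β := by
    rw [show β = sitePercolation (Site 2 × ℕ) half from rfl]; infer_instance
  haveI := isProbabilityMeasure_nuMix S
  haveI := isProbabilityMeasure_nuMix (S ∆ {i, i + 1})
  have hπ := ps2_measurable_stat i
  have h1 : (fun xu : Obs × Rnd => ((eraseMid i xu.1, stripDiagram i xu.1), xu.2)) =
      Prod.map (fun x => (eraseMid i x, stripDiagram i x)) id := by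
    funext xu; rfl
  rw [h1, ← Measure.map_prod_map _ _ hπ measurable_id, ← Measure.map_prod_map _ _ hπ measurable_id,
    Measure.map_id]
  exact congrArg (fun μ : Measure (Obs × Set (Site 2 × Site 2)) => μ.prod β) hX

/-- Certified depths are almost surely finite under the exchanged pattern (exponential tails under `S`,
transferred along `StripDiagramExchange`). [folklore] -/
theorem ps2_coal_ae_finite {C c : ℝ} (hc : 0 < c) (hX : StripDiagramExchange S i)
    (hCm : ∀ y m, MeasurableSet (Coal y m))
    (hCt : ∀ (y : ℤ) (m : ℕ), ((νmix S).prod β)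
      {xu | ((eraseMid i xu.1, stripDiagram i xu.1), xu.2) ∉ Coal y m} ≤
        ENNReal.ofReal (C * Real.exp (-c * m))) (y : ℤ) :
    ((νmix (S ∆ {i, i + 1})).prod β)
      {xu | ∀ m : ℕ, ((eraseMid i xu.1, stripDiagram i xu.1), xu.2) ∉ Coal y m} = 0 := by
  have hπid : Measurable fun xu : Obs × Rnd => ((eraseMid i xu.1, stripDiagram i xu.1), xu.2) :=
    ((ps2_measurable_stat i).comp measurable_fst).prodMk measurable_snd
  have hE : MeasurableSet {q : (Obs × Set (Site 2 × Site 2)) × Rnd | ∀ m : ℕ, q ∉ Coal y m} :=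
    measurableSet_setOf.2 (Measurable.forall fun m => (measurableSet_setOf.1 (hCm y m)).not)
  have hpre : ∀ S₀ : Set ℤ, ((νmix S₀).prod β)
      {xu | ∀ m : ℕ, ((eraseMid i xu.1, stripDiagram i xu.1), xu.2) ∉ Coal y m} =
      (((νmix S₀).prod β).map (fun xu : Obs × Rnd => ((eraseMid i xu.1, stripDiagram i xu.1), xu.2)))
        {q | ∀ m : ℕ, q ∉ Coal y m} := fun S₀ => by
    rw [Measure.map_apply hπid hE]; rfl
  rw [hpre, ← ps2_stat_prod_map S i hX, ← hpre]
  refine le_antisymm ?_ zero_le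
  have hlim : Tendsto (fun m : ℕ => ENNReal.ofReal (C * Real.exp (-c * m))) atTop (𝓝 0) := by
    rw [← ENNReal.ofReal_zero]
    refine ENNReal.tendsto_ofReal ?_
    have h1 : Tendsto (fun m : ℕ => Real.exp (-c) ^ m) atTop (𝓝 0) :=
      tendsto_pow_atTop_nhds_zero_of_lt_one (Real.exp_pos _).le
        (Real.exp_lt_one_iff.2 (by linarith))
    have h2 : (fun m : ℕ => C * Real.exp (-c * m)) = fun m => C * Real.exp (-c) ^ m := by
      funext m; rw [← Real.exp_nat_mul]; congr 2; ring
    rw [h2]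
    simpa using h1.const_mul C
  refine ge_of_tendsto hlim (Eventually.of_forall fun m => ?_)
  refine (measure_mono ?_).trans (hCt y m)
  intro xu hxu
  exact hxu m


end Assembly

end Summit.CriticalPhenomena.CardyFormulaZ2.Theorems.IKLinearTransport.PinnedDiagramExchange
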